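import Literature.AlgebraicGeometry.Motives.Varieties
import Mathlib.AlgebraicGeometry.ValuativeCriterion
import Mathlib.CategoryTheory.Monoidal.Cartesian.Over
import HarnessLib

/-!
# Integral points of proper schemes over a valuation ring (valuative criterion)

Let `O` be a commutative ring, `Ω` a field with a valuation subring `R ⊆ Ω`, and `f : O → R` a
ring map, so that `Spec R` and `Spec Ω` are `O`-schemes and the generic point
`Spec Ω → Spec R` is an `O`-morphism.  For a **proper** `O`-scheme `𝒳` the valuative criterion of
properness (Mathlib `AlgebraicGeometry.IsProper.eq_valuativeCriterion`: proper = valuative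
criterion + qcqs + locally of finite type) says exactly that restriction to the generic point

  `Hom_O(Spec R, 𝒳) → Hom_O(Spec Ω, 𝒳)`, `l ↦ (Spec Ω → Spec R) ≫ l`

is a bijection (`restrictPoint_bijective`): every `Ω`-point of `𝒳` extends uniquely to an
`R`-point.  When `𝒳` is a group scheme the restriction is a group isomorphism
(`restrictPointMulEquiv`).  This is the scheme-theoretic input of the **reduction map**
`𝒳(Ω) = 𝒳(R) → 𝒳(κ(R))` of a proper model (Hartshorne II.4.7; for abelian schemes
Bosch–Lütkebohmert–Raynaud, *Néron Models*, §1.2 Prop. 8: an abelian scheme is the Néron model of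
its generic fibre, in particular `𝒜(R) = A(Ω)`), used for abelian varieties with good reduction
over the valuation ring of `K̄_v` in `Literature/NumberTheory/DiophantineGeometry/`.

## References
* R. Hartshorne, *Algebraic Geometry*, GTM 52, Ch. II Thm. 4.7 (valuative criterion of
  properness). [cite: Hartshorne1977, II.4.7]
* S. Bosch, W. Lütkebohmert, M. Raynaud, *Néron Models*, Springer 1990, §1.2 Prop. 8.

## Mathlib
`AlgebraicGeometry.ValuativeCommSq`, `AlgebraicGeometry.ValuativeCriterion`,
`AlgebraicGeometry.IsProper.eq_valuativeCriterion`, `CategoryTheory.CommSq.LiftStruct`,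
`CategoryTheory.GrpObj` / `MonObj` on over categories (`Hom.group`).
-/

noncomputable section

open CategoryTheory CategoryTheory.Limits AlgebraicGeometry
open scoped MonObj

universe u

namespace Literature.AlgebraicGeometry.Motives

variable {O : Type u} [CommRing O] {Ω : Type u} [Field Ω] (R : ValuationSubring Ω) (f : O →+* R)

/-- `Spec R` as an `O`-scheme, for a valuation subring `R ⊆ Ω` and a ring map `f : O → R`.
[folklore] -/
abbrev specValuationSubring : SchemeOver O :=
  Over.mk (Spec.map (CommRingCat.ofHom f))

/-- `Spec k` as an `O`-scheme through `O → R → k`, for a ring map `g : R → k` (the cases of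
interest: `k = Ω = Frac R` and `k` the residue field of `R`). [folklore] -/
abbrev specRingHomOver {k : Type u} [CommRing k] (g : R →+* k) : SchemeOver O :=
  Over.mk (Spec.map (CommRingCat.ofHom g) ≫ Spec.map (CommRingCat.ofHom f))

/-- The structure morphism `Spec k → Spec R` over `O`. [folklore] -/
abbrev specRingHomι {k : Type u} [CommRing k] (g : R →+* k) :
    specRingHomOver R f g ⟶ specValuationSubring R f :=
  Over.homMk (Spec.map (CommRingCat.ofHom g)) rfl

/-- `Spec Ω` as an `O`-scheme through `O → R ⊆ Ω`. [folklore] -/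
abbrev specFractionField : SchemeOver O :=
  specRingHomOver R f (algebraMap R Ω)

/-- The generic point `Spec Ω → Spec R` as an `O`-morphism. [folklore] -/
abbrev specFractionFieldι : specFractionField R f ⟶ specValuationSubring R f :=
  specRingHomι R f (algebraMap R Ω)

variable (𝒳 : SchemeOver O)

/-- Restriction of an `R`-point of `𝒳` to its generic point, an `Ω`-point. [folklore] -/
def restrictPoint (l : specValuationSubring R f ⟶ 𝒳) : specFractionField R f ⟶ 𝒳 :=
  specFractionFieldι R f ≫ l

/-- Underlying morphism of a restricted point. [folklore] -/
@[simp] theorem restrictPoint_left (l : specValuationSubring R f ⟶ 𝒳) :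
    (restrictPoint R f 𝒳 l).left = Spec.map (CommRingCat.ofHom (algebraMap R Ω)) ≫ l.left := rfl

/-- The valuative commutative square `Spec Ω → 𝒳.left`, `Spec R → Spec O` attached to an `Ω`-point
of the `O`-scheme `𝒳`. [folklore] -/
def valuativeCommSqOfPoint (P : specFractionField R f ⟶ 𝒳) : ValuativeCommSq 𝒳.hom where
  R := R
  K := Ω
  i₁ := P.left
  i₂ := Spec.map (CommRingCat.ofHom f)
  commSq := ⟨Over.w P⟩

/-- A proper morphism satisfies the valuative criterion (one direction of Mathlib's
`IsProper.eq_valuativeCriterion`). [cite: Hartshorne1977, II.4.7] -/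
theorem valuativeCriterion_of_isProper {X Y : Scheme.{u}} (g : X ⟶ Y) [IsProper g] :
    ValuativeCriterion g := by
  have h : (ValuativeCriterion ⊓ @QuasiCompact ⊓ @QuasiSeparated ⊓ @LocallyOfFiniteType) g := by
    rw [← IsProper.eq_valuativeCriterion]; infer_instance
  exact h.1.1.1

/-- **Valuative criterion of properness, as a bijection on points.**  For a proper `O`-scheme `𝒳`,
restriction `Hom_O(Spec R, 𝒳) → Hom_O(Spec Ω, 𝒳)` to the generic point of the valuation ring `R`
of `Ω` is bijective: every `Ω`-point extends uniquely to an `R`-point.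
[cite: Hartshorne1977, II.4.7] -/
theorem restrictPoint_bijective [IsProper 𝒳.hom] :
    Function.Bijective (restrictPoint R f 𝒳) := by
  have hvc := valuativeCriterion_of_isProper 𝒳.hom
  refine ⟨fun l₁ l₂ h ↦ ?_, fun P ↦ ?_⟩
  · obtain ⟨huniq⟩ := hvc (valuativeCommSqOfPoint R f 𝒳 (restrictPoint R f 𝒳 l₁))
    have hsub : Subsingleton
        (valuativeCommSqOfPoint R f 𝒳 (restrictPoint R f 𝒳 l₁)).commSq.LiftStruct :=
      inferInstance
    let L₁ : (valuativeCommSqOfPoint R f 𝒳 (restrictPoint R f 𝒳 l₁)).commSq.LiftStruct :=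
      { l := l₁.left
        fac_left := rfl
        fac_right := Over.w l₁ }
    let L₂ : (valuativeCommSqOfPoint R f 𝒳 (restrictPoint R f 𝒳 l₁)).commSq.LiftStruct :=
      { l := l₂.left
        fac_left := by
          change Spec.map (CommRingCat.ofHom (algebraMap R Ω)) ≫ l₂.left =
            (restrictPoint R f 𝒳 l₁).left
          rw [h]; rfl
        fac_right := Over.w l₂ }
    have hL : L₁ = L₂ := hsub.elim L₁ L₂
    ext : 1
    exact congrArg CommSq.LiftStruct.l hL
  · obtain ⟨huniq⟩ := hvc (valuativeCommSqOfPoint R f 𝒳 P)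
    let L : (valuativeCommSqOfPoint R f 𝒳 P).commSq.LiftStruct := default
    refine ⟨Over.homMk L.l L.fac_right, ?_⟩
    ext : 1
    exact L.fac_left

/-- The unique `R`-point extending an `Ω`-point of a proper `O`-scheme. [cite: Hartshorne1977, II.4.7] -/
def extendPoint [IsProper 𝒳.hom] (P : specFractionField R f ⟶ 𝒳) : specValuationSubring R f ⟶ 𝒳 :=
  (Equiv.ofBijective _ (restrictPoint_bijective R f 𝒳)).symm P

/-- `extendPoint` is a right inverse of `restrictPoint`. [folklore] -/
@[simp] theorem restrictPoint_extendPoint [IsProper 𝒳.hom] (P : specFractionField R f ⟶ 𝒳) :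
    restrictPoint R f 𝒳 (extendPoint R f 𝒳 P) = P :=
  (Equiv.ofBijective _ (restrictPoint_bijective R f 𝒳)).apply_symm_apply P

/-- `extendPoint` is a left inverse of `restrictPoint`. [folklore] -/
@[simp] theorem extendPoint_restrictPoint [IsProper 𝒳.hom] (l : specValuationSubring R f ⟶ 𝒳) :
    extendPoint R f 𝒳 (restrictPoint R f 𝒳 l) = l :=
  (Equiv.ofBijective _ (restrictPoint_bijective R f 𝒳)).symm_apply_apply l

/-- Characterisation of the extension: `extendPoint P = l ↔ restrictPoint l = P`. [folklore] -/
theorem extendPoint_eq_iff [IsProper 𝒳.hom] (P : specFractionField R f ⟶ 𝒳)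
    (l : specValuationSubring R f ⟶ 𝒳) : extendPoint R f 𝒳 P = l ↔ restrictPoint R f 𝒳 l = P := by
  constructor
  · rintro rfl; exact restrictPoint_extendPoint R f 𝒳 P
  · rintro rfl; exact extendPoint_restrictPoint R f 𝒳 l

/-! ## Group schemes: restriction and extension are group isomorphisms -/

section Group

variable [GrpObj 𝒳]

/-- For a group scheme `𝒳` over `O`, restriction of points along any `O`-morphism is a group
homomorphism (functoriality of the group structure on `Hom(-, 𝒳)`, Mathlib `MonObj.comp_mul`).
[folklore] -/
theorem restrictPoint_mul (l l' : specValuationSubring R f ⟶ 𝒳) :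
    restrictPoint R f 𝒳 (l * l') = restrictPoint R f 𝒳 l * restrictPoint R f 𝒳 l' :=
  MonObj.comp_mul _ _ _

/-- Restriction preserves the unit point. [folklore] -/
theorem restrictPoint_one : restrictPoint R f 𝒳 1 = 1 :=
  MonObj.comp_one _

/-- Restriction of points as a monoid homomorphism `𝒳(R) →* 𝒳(Ω)`. [folklore] -/
def restrictPointMonoidHom : (specValuationSubring R f ⟶ 𝒳) →* (specFractionField R f ⟶ 𝒳) where
  toFun := restrictPoint R f 𝒳
  map_one' := restrictPoint_one R f 𝒳
  map_mul' := restrictPoint_mul R f 𝒳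

/-- Unfolding lemma. [folklore] -/
@[simp] theorem restrictPointMonoidHom_apply (l : specValuationSubring R f ⟶ 𝒳) :
    restrictPointMonoidHom R f 𝒳 l = restrictPoint R f 𝒳 l := rfl

/-- **Integral points of a proper group scheme**: for a proper group scheme `𝒳` over `O`,
restriction to the generic point is a group isomorphism `𝒳(R) ≃* 𝒳(Ω)`.
[cite: Hartshorne1977, II.4.7] -/
def restrictPointMulEquiv [IsProper 𝒳.hom] :
    (specValuationSubring R f ⟶ 𝒳) ≃* (specFractionField R f ⟶ 𝒳) :=
  MulEquiv.ofBijective (restrictPointMonoidHom R f 𝒳) (restrictPoint_bijective R f 𝒳)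

/-- Unfolding lemma. [folklore] -/
@[simp] theorem restrictPointMulEquiv_apply [IsProper 𝒳.hom] (l : specValuationSubring R f ⟶ 𝒳) :
    restrictPointMulEquiv R f 𝒳 l = restrictPoint R f 𝒳 l := rfl

/-- The inverse of `restrictPointMulEquiv` is `extendPoint`. [folklore] -/
theorem restrictPointMulEquiv_symm_apply [IsProper 𝒳.hom] (P : specFractionField R f ⟶ 𝒳) :
    (restrictPointMulEquiv R f 𝒳).symm P = extendPoint R f 𝒳 P := rfl

/-- Base change of `R`-points along a ring map `g : R → k` (precomposition with
`Spec k → Spec R`), as a monoid homomorphism `𝒳(R) →* 𝒳(k)`. [folklore] -/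
def compPointMonoidHom {k : Type u} [CommRing k] (g : R →+* k) :
    (specValuationSubring R f ⟶ 𝒳) →* (specRingHomOver R f g ⟶ 𝒳) where
  toFun l := specRingHomι R f g ≫ l
  map_one' := MonObj.comp_one _
  map_mul' := MonObj.comp_mul _

/-- Unfolding lemma. [folklore] -/
@[simp] theorem compPointMonoidHom_apply {k : Type u} [CommRing k] (g : R →+* k)
    (l : specValuationSubring R f ⟶ 𝒳) : compPointMonoidHom R f 𝒳 g l = specRingHomι R f g ≫ l :=
  rfl

/-- **The reduction map of a proper group scheme** along `g : R → k` (e.g. the residue map of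
`R`): an `Ω`-point extends uniquely to an `R`-point (`extendPoint`), which is then specialised
along `Spec k → Spec R`; a group homomorphism `𝒳(Ω) →* 𝒳(k)`.  Bosch–Lütkebohmert–Raynaud,
*Néron Models*, §1.2 Prop. 8 with Hartshorne II.4.7. [cite: Hartshorne1977, II.4.7] -/
def reducePointMonoidHom [IsProper 𝒳.hom] {k : Type u} [CommRing k] (g : R →+* k) :
    (specFractionField R f ⟶ 𝒳) →* (specRingHomOver R f g ⟶ 𝒳) :=
  (compPointMonoidHom R f 𝒳 g).comp (restrictPointMulEquiv R f 𝒳).symm.toMonoidHom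

/-- Unfolding lemma: reduce = extend, then specialise. [folklore] -/
theorem reducePointMonoidHom_apply [IsProper 𝒳.hom] {k : Type u} [CommRing k] (g : R →+* k)
    (P : specFractionField R f ⟶ 𝒳) :
    reducePointMonoidHom R f 𝒳 g P = specRingHomι R f g ≫ extendPoint R f 𝒳 P := rfl

/-- Extension of points is multiplicative. [folklore] -/
theorem extendPoint_mul [IsProper 𝒳.hom] (P Q : specFractionField R f ⟶ 𝒳) :
    extendPoint R f 𝒳 (P * Q) = extendPoint R f 𝒳 P * extendPoint R f 𝒳 Q := by
  rw [← restrictPointMulEquiv_symm_apply, map_mul, restrictPointMulEquiv_symm_apply,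
    restrictPointMulEquiv_symm_apply]

end Group

/-! ## Functoriality in automorphisms of `R` over `O` (Galois equivariance of extension and
reduction) -/

section Naturality

variable {R f}

/-- An `O`-endomorphism of `Spec R` from a ring endomorphism `σ` of `R` fixing the image of `O`.
[folklore] -/
abbrev specValuationSubringMap (σ : R →+* R) (hσ : σ.comp f = f) :
    specValuationSubring R f ⟶ specValuationSubring R f :=
  Over.homMk (Spec.map (CommRingCat.ofHom σ)) (by
    change Spec.map _ ≫ Spec.map _ = Spec.map _
    rw [← Spec.map_comp, ← CommRingCat.ofHom_comp, hσ])

/-- An `O`-endomorphism of `Spec k` from compatible ring endomorphisms `σ` of `R` (over `O`) and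
`σk` of `k` (`σk ∘ g = g ∘ σ`). [folklore] -/
abbrev specRingHomOverMap {k : Type u} [CommRing k] (g : R →+* k) (σ : R →+* R) (hσ : σ.comp f = f)
    (σk : k →+* k) (hk : σk.comp g = g.comp σ) :
    specRingHomOver R f g ⟶ specRingHomOver R f g :=
  Over.homMk (Spec.map (CommRingCat.ofHom σk)) (by
    change Spec.map _ ≫ Spec.map _ ≫ Spec.map _ = Spec.map _ ≫ Spec.map _
    rw [← Spec.map_comp_assoc, ← CommRingCat.ofHom_comp, hk, CommRingCat.ofHom_comp,
      Spec.map_comp_assoc, ← Spec.map_comp, ← Spec.map_comp, ← CommRingCat.ofHom_comp,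
      ← CommRingCat.ofHom_comp, hσ, CommRingCat.ofHom_comp, Spec.map_comp])

/-- Compatibility of the induced endomorphisms of `Spec k` and `Spec R`. [folklore] -/
theorem specRingHomOverMap_comp_ι {k : Type u} [CommRing k] (g : R →+* k) (σ : R →+* R)
    (hσ : σ.comp f = f) (σk : k →+* k) (hk : σk.comp g = g.comp σ) :
    specRingHomOverMap g σ hσ σk hk ≫ specRingHomι R f g =
      specRingHomι R f g ≫ specValuationSubringMap σ hσ := by
  ext : 1
  change Spec.map _ ≫ Spec.map _ = Spec.map _ ≫ Spec.map _
  rw [← Spec.map_comp, ← Spec.map_comp, ← CommRingCat.ofHom_comp, ← CommRingCat.ofHom_comp, hk]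

variable (R f)

/-- **Uniqueness makes extension natural**: if `τ'` on `Spec Ω` and `τ` on `Spec R` are compatible
`O`-endomorphisms, then `extendPoint (τ' ≫ P) = τ ≫ extendPoint P`. [cite: Hartshorne1977, II.4.7] -/
theorem extendPoint_naturality [IsProper 𝒳.hom]
    (τ : specValuationSubring R f ⟶ specValuationSubring R f)
    (τ' : specFractionField R f ⟶ specFractionField R f)
    (hτ : τ' ≫ specFractionFieldι R f = specFractionFieldι R f ≫ τ)
    (P : specFractionField R f ⟶ 𝒳) :
    extendPoint R f 𝒳 (τ' ≫ P) = τ ≫ extendPoint R f 𝒳 P := by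
  rw [extendPoint_eq_iff]
  change specFractionFieldι R f ≫ τ ≫ extendPoint R f 𝒳 P = τ' ≫ P
  rw [← Category.assoc, ← hτ, Category.assoc]
  congr 1
  exact restrictPoint_extendPoint R f 𝒳 P

/-- **Equivariance of the reduction map**: for compatible endomorphisms `σ` of `R` over `O`,
`σΩ` of `Ω` and `σk` of `k`, the reduction map `𝒳(Ω) → 𝒳(k)` of a proper group scheme
intertwines the induced maps on points. [cite: Hartshorne1977, II.4.7] -/
theorem reducePointMonoidHom_naturality [GrpObj 𝒳] [IsProper 𝒳.hom] {k : Type u} [CommRing k]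
    (g : R →+* k) (σ : R →+* R) (hσ : σ.comp f = f)
    (σΩ : Ω →+* Ω) (hΩ : σΩ.comp (algebraMap R Ω) = (algebraMap R Ω).comp σ)
    (σk : k →+* k) (hk : σk.comp g = g.comp σ) (P : specFractionField R f ⟶ 𝒳) :
    reducePointMonoidHom R f 𝒳 g (specRingHomOverMap (algebraMap R Ω) σ hσ σΩ hΩ ≫ P) =
      specRingHomOverMap g σ hσ σk hk ≫ reducePointMonoidHom R f 𝒳 g P := by
  rw [reducePointMonoidHom_apply, reducePointMonoidHom_apply,
    extendPoint_naturality R f 𝒳 (specValuationSubringMap σ hσ) _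
      (specRingHomOverMap_comp_ι (algebraMap R Ω) σ hσ σΩ hΩ),
    ← Category.assoc, ← specRingHomOverMap_comp_ι g σ hσ σk hk, Category.assoc]

end Naturality

end Literature.AlgebraicGeometry.Motives
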